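import Summits.NavierStokesRegularity.NavierStokesRegularity.Theorems.HalfSpaceWindowDoorCirculationCarryingRigidityFarPastTiltLiouville
import HarnessLib

/-!
# Blow-up scenario census — CLOSED ROWS folded BY NAME, file 2 (row A2sc: sign + circle-averaged cone,
# axis-Type-I envelope; far-past form)

Cell `pub/ns-census` (`SCENARIO-CENSUS.md` v1.47 NEW ROW A2sc, WIDENED v1.50 per the refuter's SWEEP 9 FINDING C;
lead §6 «one-liners … `Row_A2sc` + `row_A2sc_excluded`»; `ScenarioCensusClosedItems.lean` is full, so closed-row
aliases continue here).  Pattern of the census: `Row_<key> : Prop := <the closing statement, binders verbatim>` and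
`theorem row_<key>_excluded : Row_<key> := <the tree theorem BY NAME>`.  CONED FILE (it imports the
`HalfSpaceWindowDoor…CirculationCarryingRigidity*` Theorems chain); nothing cone-free should import it.

* `Row_A2sc` — Type I in time (`HasTypeITimeDecay C v`), genuine KNSS-gauge class (continuous on `(−∞,0) × ℝ³`,
  Oseen–Duhamel identity at `ν = 1`, divergence-free slices) WITH the AXIS-Type-I envelope
  `‖v t x‖ ≤ D / (cylRadius x + √(−t))`, the SIGN `ω₃ ≥ 0` and the circle-averaged one-sided cone `GlobalCone v`
  ⇒ `v ≡ 0`; closed by `…AxisTypeILiouville.eq_zero_of_axisTypeI_signE3_globalCone` (`row_A2sc_excluded`).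
* `Row_A2scFar` — the FAR-PAST form (envelope, sign and cone only for the shifted field `τ ↦ v (τ + s₁)`, any
  `s₁ ≤ 0`) ⇒ `v ≡ 0`; closed by `…FarPastTiltLiouville.eq_zero_of_farPast_axisTypeI_signE3_globalCone`
  (`row_A2scFar_excluded`); `row_A2sc_of_row_A2scFar` (s₁ = 0).

No summit statement is proved here; every theorem below is an existing tree theorem cited BY NAME; nothing in this
file is a claim about NS regularity beyond those statements.
-/

noncomputable section

-- the summit and its single problem share the name `NavierStokesRegularity` (D-0017 nested layout)
set_option linter.dupNamespace false

open Set Function Filter Topology MeasureTheory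


namespace Summit.NavierStokesRegularity.NavierStokesRegularity.Theorems.ScenarioCensus

open Literature.Analysis Literature.Analysis.FluidPDE Literature.Analysis.UnboundedOperators
open Summit.NavierStokesRegularity.NavierStokesRegularity.Theorems.AxisTwistDoorAveragedConeLiouvilleDefs
  (SignE3 GlobalCone)

/-! ## A2sc: sign + circle-averaged cone with the axis-Type-I envelope (census v1.47 / v1.50) -/

/-- Census row A2sc — (Type I in time, genuine KNSS-gauge ancient mild class: `HasTypeITimeDecay C v`, continuous
on `(−∞,0) × ℝ³`, Oseen–Duhamel identity `ν = 1`, divergence-free slices · no symmetry; instead the ANALYTIC side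
condition SIGN `ω₃ ≥ 0` and the circle-averaged one-sided cone `GlobalCone v` about `+e₃` · WITH the axis-Type-I
envelope `‖v t x‖ ≤ D / (cylRadius x + √(−t))`): `v ≡ 0`.  The binders of
`HalfSpaceWindowDoorCirculationCarryingRigidityAxisTypeILiouville.eq_zero_of_axisTypeI_signE3_globalCone` verbatim.
Value: EXCLUDED-IN-TREE (`row_A2sc_excluded`). -/
def Row_A2sc : Prop :=
  ∀ (C D : ℝ) (v : ℝ → EuclideanSpace ℝ (Fin 3) → EuclideanSpace ℝ (Fin 3)),
    HasTypeITimeDecay C v →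
    ContinuousOn (uncurry v) (Iio (0 : ℝ) ×ˢ univ) →
    (∀ s t : ℝ, s < t → t < 0 → ∀ x,
      v t x = heatExtension (v s) (t - s) x - oseenDuhamel 1 s v v t x) →
    (∀ t < 0, VectorCalculus.IsDivFree (v t)) →
    (∀ t < 0, ∀ x : EuclideanSpace ℝ (Fin 3), ‖v t x‖ ≤ D / (cylRadius x + Real.sqrt (-t))) →
    (∀ s < 0, ∀ y, 0 ≤ inner ℝ (curl (v s) y) (EuclideanSpace.single (2 : Fin 3) (1 : ℝ))) →
    GlobalCone v → ∀ t < 0, ∀ x, v t x = 0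

/-- Row A2sc is EXCLUDED-IN-TREE: `…AxisTypeILiouville.eq_zero_of_axisTypeI_signE3_globalCone` (route
HalfSpaceWindowDoor, crux CirculationCarryingRigidity; circulation-carrying rigidity — tilt circulation `≤ K ∮ω₃`,
radial drift `β = T/∮ω₃`, flux decay at the apex, the door's axis-Type-I Liouville theorem). -/
theorem row_A2sc_excluded : Row_A2sc :=
  HalfSpaceWindowDoorCirculationCarryingRigidityAxisTypeILiouville.eq_zero_of_axisTypeI_signE3_globalCone

/-- Census row A2sc, FAR-PAST form — same class; the axis-Type-I envelope, the sign `SignE3` and the cone `GlobalCone`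
are assumed only for the time-shifted field `τ ↦ v (τ + s₁)` (`s₁ ≤ 0`, i.e. only at times `< s₁`): `v ≡ 0` on the
whole slab.  The binders of `…FarPastTiltLiouville.eq_zero_of_farPast_axisTypeI_signE3_globalCone` verbatim.
Value: EXCLUDED-IN-TREE (`row_A2scFar_excluded`). -/
def Row_A2scFar : Prop :=
  ∀ (C D : ℝ) (v : ℝ → EuclideanSpace ℝ (Fin 3) → EuclideanSpace ℝ (Fin 3)),
    HasTypeITimeDecay C v →
    ContinuousOn (uncurry v) (Iio (0 : ℝ) ×ˢ univ) →
    (∀ s t : ℝ, s < t → t < 0 → ∀ x,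
      v t x = heatExtension (v s) (t - s) x - oseenDuhamel 1 s v v t x) →
    (∀ t < 0, VectorCalculus.IsDivFree (v t)) →
    ∀ {s₁ : ℝ}, s₁ ≤ 0 →
    (∀ τ < 0, ∀ x : EuclideanSpace ℝ (Fin 3), ‖v (τ + s₁) x‖ ≤ D / (cylRadius x + Real.sqrt (-τ))) →
    SignE3 (fun τ => v (τ + s₁)) → GlobalCone (fun τ => v (τ + s₁)) →
    ∀ t < 0, ∀ x, v t x = 0

/-- Row A2sc (far-past form) is EXCLUDED-IN-TREE:
`…FarPastTiltLiouville.eq_zero_of_farPast_axisTypeI_signE3_globalCone`. -/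
theorem row_A2scFar_excluded : Row_A2scFar :=
  fun C D v hrate hcont hmild hdiv _ hs₁ hDax hsign hcone =>
    HalfSpaceWindowDoorCirculationCarryingRigidityFarPastTiltLiouville.eq_zero_of_farPast_axisTypeI_signE3_globalCone
      C D v hrate hcont hmild hdiv hs₁ hDax hsign hcone

/-- Lattice: the far-past form contains the primary cell (`s₁ = 0`). -/
theorem row_A2sc_of_row_A2scFar (h : Row_A2scFar) : Row_A2sc := by
  intro C D v hrate hcont hmild hdiv hDax hsign hcone
  have hv : (fun τ => v (τ + 0)) = v := by simp only [add_zero]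
  refine h C D v hrate hcont hmild hdiv le_rfl ?_ ?_ ?_
  · simpa only [add_zero] using hDax
  · rw [hv]; exact hsign
  · rw [hv]; exact hcone

end Summit.NavierStokesRegularity.NavierStokesRegularity.Theorems.ScenarioCensus

end
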